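import Summits.BirchSwinnertonDyer.BirchSwinnertonDyer.Theorems.AlignedTransportAtTwoMainConjectureOfRankZeroBSDAtTwoFineRoadTowerImageDelta
import Summits.BirchSwinnertonDyer.BirchSwinnertonDyer.Theorems.ByReductionTypeAtTwoMultTransportResidual
import Literature.NumberTheory.EllipticCurves.CyclotomicZpExtensionLayerOneSqrtTwoProofs
import HarnessLib

/-!
# The quadratic numbers of the cyclotomic `ℤ₂`-tower are `ℚ ∪ ℚ·√2`: `√q ∈ ℚ_∞ ⟺ q ∈ ℚ^{×2} ∪ 2ℚ^{×2}`; hence on the seed cell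
# `Gal(ℚ̄/ℚ_∞)` acts on `E[2]` through `S₃` iff `2Δ_E ∉ ℚ^{×2}`, and through `C₃` iff `2Δ_E ∈ ℚ^{×2}`

Cell `bsd-f1-sign2`, WIDTH-5 attach seat `bsd-line-att-p5` (gen 7) on line `birth` of crux C2 stmt-BirchSwinnertonDyer-22298
`MainConjectureOfRankZeroBSDAtTwo` (route `AlignedTransportAtTwo`); sequel of `…FineRoadTowerImageDelta` (att-p5 g7), which reduced
the `C₃ / S₃` dichotomy of the att-p3 counting lemmas (`G_∞ = image of Gal(ℚ̄/ℚ_∞)` in `Aut(W[2])`) to «`δ ∈ ℚ_∞`?», `16δ² = Δ`.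
A `--supports 22298 --as helper` file. HONEST FRAMING: THEOREMS ONLY — no definition, no named fact, no `sorry`; C2-NEUTRAL; BSD is NOT
proved by any of this.

WHAT.
* §1 (any field `K`, any `ℤ₂`-extension `κ`, `x ∈ K̄` with `σx = ±x` for all `σ`): `layerSubgroup_one_le_stabilizer` — if `x ∈ K_∞` then
  `Gal(K̄/K_1)` fixes `x` (every element of `κ⁻¹(2ℤ₂)` is a square times an element of `ker κ`); `stabilizer_eq_layerSubgroup_one` — if
  moreover `x ∉ K` then `Stab(x) = Gal(K̄/K_1)` (index count: `[Γ_K : κ⁻¹(2ℤ₂)] = 2`); `smul_mul_eq_of_mem_top` — two such IRRATIONAL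
  `x, θ ∈ K_∞` have a `Γ_K`-fixed product (`K_∞` has ONE quadratic subfield).
* §2 (`K = ℚ`, cyclotomic `κ`, `√2 ∈ ℚ_1` from the tree's `ZpExtension.IsCyclotomic.exists_sq_eq_two_layer_one`):
  **`mem_top_iff_isSquare_or_isSquare_two_mul`** — for `x² = q ∈ ℚ`: `x ∈ ℚ_∞ ⟺ q ∈ ℚ^{×2} ∨ 2q ∈ ℚ^{×2}` (Washington §13.1:
  `ℚ_1 = ℚ(√2)` is the unique quadratic subfield of `ℚ_∞`).
* §3 elliptic curves over `ℚ`, cyclotomic `ℤ₂`-extension: **`delta_mem_top_iff`** (`δ ∈ ℚ_∞ ⟺ Δ ∈ ℚ^{×2} ∨ 2Δ ∈ ℚ^{×2}`);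
  **`exists_transposition_mem_kerSubgroup_iff_not_isSquare`** / **`forall_trivial_or_fpf_iff_isSquare_two_mul`**: on the seed cell of
  crux C2 (no rational `2`-torsion, `Δ ∉ ℚ^{×2}`) `Gal(ℚ̄/ℚ_∞)` contains a transposition on `E[2]` (`G_∞ ≅ S₃`) iff `2Δ ∉ ℚ^{×2}`, and has
  none (`G_∞ ≅ C₃`, every element trivial or fixed-point-free) iff `2Δ ∈ ℚ^{×2}`; `S3_data_of_not_isSquare_two_mul`,
  `C3_data_of_isSquare_two_mul` hand the att-p3 counting lemmas their group-theoretic hypotheses in each case. This answers the lead's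
  census question (att-p5 g6 NOT-DONE (iii)) «image of Gal(ℚ̄/ℚ_∞) in Aut W[2] = S₃ unless Δ ∈ 2ℚ²» in the kernel.

References: L. Washington, *Introduction to Cyclotomic Fields* (2nd ed. 1997) §13.1 (`ℚ_1 = ℚ(√2)`, `Gal(ℚ_∞/ℚ) ≅ ℤ₂`); J.-P. Serre,
Invent. Math. 15 (1972) §5.3; T. Dokchitser, V. Dokchitser, Math. Z. 272 (2012) (proof of Thm.: `ℚ(E[2]) ⊇ ℚ(√Δ)`); the crux
workfile `PERFECT-DESCENT.md` §3 (iii).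
-/

set_option autoImplicit false
-- the Theorems namespace of this sub repeats the summit name by design (D-0017 nested layout)
set_option linter.dupNamespace false

noncomputable section

open scoped Classical

namespace Summit.BirchSwinnertonDyer.BirchSwinnertonDyer.Theorems.AlignedTransportAtTwoFineRoad.TowerImageQuadratic

open WeierstrassCurve Field Literature.NumberTheory.EllipticCurves Literature.NumberTheory.GaloisRepresentations
  Literature.NumberTheory.EllipticCurves.Rank1Residual Literature.NumberTheory.EllipticCurves.Greenberg1999
  Literature.NumberTheory.EllipticCurves.DokchitserDokchitser2012
  Summit.BirchSwinnertonDyer.BirchSwinnertonDyer.Theorems.AlignedTransportAtTwoFineRoad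
  Summit.BirchSwinnertonDyer.BirchSwinnertonDyer.Theorems.AlignedTransportAtTwoFineRoad.TowerImage
  Summit.BirchSwinnertonDyer.BirchSwinnertonDyer.Theorems.AlignedTransportAtTwoFineRoad.TowerImageDelta

universe u

/-! ## §1 Quadratic elements of a `ℤ₂`-tower: stabiliser `= Gal(K̄/K_1)` -/

section Layer

variable {K : Type u} [Field K] (κ : ZpExtension K 2)

/-- **`x ∈ K_∞` with `σx = ±x` for all `σ` is fixed by `Gal(K̄/K_1) = κ⁻¹(2ℤ₂)`**: an element of `κ⁻¹(2ℤ₂)` is `τ² h` with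
`h ∈ ker κ` (surjectivity of `κ`), and `τ(τx) = x` whatever the sign. [cite: Washington1997, §13.1] -/
theorem layerSubgroup_one_le_stabilizer {x : AlgebraicClosure K} (hx : x ∈ κ.top)
    (hpm : ∀ σ : absoluteGaloisGroup K, σ • x = x ∨ σ • x = -x) :
    κ.layerSubgroup 1 ≤ MulAction.stabilizer (absoluteGaloisGroup K) x := by
  intro σ hσ
  rw [ZpExtension.mem_layerSubgroup, pow_one] at hσ
  obtain ⟨y, hy⟩ := hσ
  obtain ⟨τ, hτ⟩ := κ.surjective (Multiplicative.ofAdd y)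
  have hτ' : κ τ = Multiplicative.ofAdd y := hτ
  have hh : (τ ^ 2)⁻¹ * σ ∈ κ.kerSubgroup := by
    rw [ZpExtension.mem_kerSubgroup, map_mul, map_inv, map_pow, hτ', ← ofAdd_nsmul, nsmul_eq_mul, ← hy, ofAdd_toAdd,
      inv_mul_cancel]
  have hfix : ((τ ^ 2)⁻¹ * σ) • x = x := (mem_top_iff_forall_smul_eq κ x).mp hx _ hh
  rw [MulAction.mem_stabilizer_iff]
  have e : σ = τ ^ 2 * ((τ ^ 2)⁻¹ * σ) := by rw [mul_inv_cancel_left]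
  rw [e, mul_smul, hfix, pow_two, mul_smul]
  rcases hpm τ with h | h
  · rw [h, h]
  · rw [h, smul_neg, h, neg_neg]

/-- **For an IRRATIONAL such `x ∈ K_∞` the stabiliser IS `Gal(K̄/K_1)`**: it contains `κ⁻¹(2ℤ₂)`, which has index `2`
(`ZpExtension.index_layerSubgroup`), and is proper. (`K_∞` has exactly one quadratic subfield, `K_1`.) [cite: Washington1997, §13.1] -/
theorem stabilizer_eq_layerSubgroup_one {x : AlgebraicClosure K} (hx : x ∈ κ.top)
    (hpm : ∀ σ : absoluteGaloisGroup K, σ • x = x ∨ σ • x = -x) (hirr : ∃ σ₀ : absoluteGaloisGroup K, σ₀ • x ≠ x) :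
    MulAction.stabilizer (absoluteGaloisGroup K) x = κ.layerSubgroup 1 := by
  have hle := layerSubgroup_one_le_stabilizer κ hx hpm
  have h2 : (κ.layerSubgroup 1).index = 2 := by rw [ZpExtension.index_layerSubgroup, pow_one]
  have hdvd : (MulAction.stabilizer (absoluteGaloisGroup K) x).index ∣ 2 := h2 ▸ Subgroup.index_dvd_of_le hle
  have hne1 : (MulAction.stabilizer (absoluteGaloisGroup K) x).index ≠ 1 := by
    rw [Ne, Subgroup.index_eq_one, Subgroup.eq_top_iff']
    intro h
    obtain ⟨σ₀, hσ₀⟩ := hirr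
    exact hσ₀ (MulAction.mem_stabilizer_iff.mp (h σ₀))
  have hidx : (MulAction.stabilizer (absoluteGaloisGroup K) x).index = 2 :=
    ((Nat.dvd_prime Nat.prime_two).mp hdvd).resolve_left hne1
  refine le_antisymm ?_ hle
  have hrel := Subgroup.relIndex_mul_index hle
  rw [hidx, h2] at hrel
  exact Subgroup.relIndex_eq_one.mp (by omega)

/-- **Two irrational "square-root" elements of `K_∞` have a `Γ_K`-fixed product**: both stabilisers are `Gal(K̄/K_1)`, so every `σ`
fixes both or negates both. [cite: Washington1997, §13.1] -/
theorem forall_smul_mul_eq {x θ : AlgebraicClosure K} (hx : x ∈ κ.top) (hθ : θ ∈ κ.top)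
    (hxpm : ∀ σ : absoluteGaloisGroup K, σ • x = x ∨ σ • x = -x) (hθpm : ∀ σ : absoluteGaloisGroup K, σ • θ = θ ∨ σ • θ = -θ)
    (hxirr : ∃ σ₀ : absoluteGaloisGroup K, σ₀ • x ≠ x) (hθirr : ∃ σ₀ : absoluteGaloisGroup K, σ₀ • θ ≠ θ)
    (σ : absoluteGaloisGroup K) : σ • (x * θ) = x * θ := by
  have hS : MulAction.stabilizer (absoluteGaloisGroup K) x = MulAction.stabilizer (absoluteGaloisGroup K) θ := by
    rw [stabilizer_eq_layerSubgroup_one κ hx hxpm hxirr, stabilizer_eq_layerSubgroup_one κ hθ hθpm hθirr]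
  rw [smul_mul']
  by_cases hσ : σ • x = x
  · have hσθ : σ • θ = θ := MulAction.mem_stabilizer_iff.mp (hS ▸ MulAction.mem_stabilizer_iff.mpr hσ)
    rw [hσ, hσθ]
  · have hσθ : σ • θ ≠ θ := fun h ↦ hσ (MulAction.mem_stabilizer_iff.mp (hS ▸ MulAction.mem_stabilizer_iff.mpr h))
    rw [(hxpm σ).resolve_left hσ, (hθpm σ).resolve_left hσθ, neg_mul_neg]

omit κ in
/-- If `x² ∈ K` then `σx = ±x` for every `σ ∈ Γ_K`. [folklore] -/
theorem smul_eq_or_eq_neg_of_sq_eq {x : AlgebraicClosure K} {q : K} (hq : x ^ 2 = algebraMap K (AlgebraicClosure K) q)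
    (σ : absoluteGaloisGroup K) : σ • x = x ∨ σ • x = -x := by
  apply eq_or_eq_neg_of_sq_eq_sq
  rw [← smul_pow', hq, absoluteGaloisGroup.smul_def]
  exact (absoluteGaloisGroup.toAlgEquiv K σ).commutes q

end Layer

/-! ## §2 `K = ℚ`, cyclotomic `κ`: `√q ∈ ℚ_∞ ⟺ q ∈ ℚ^{×2} ∪ 2ℚ^{×2}` -/

section Rat

variable (κ : ZpExtension ℚ 2)

/-- The rationals lie in `ℚ_∞`. [folklore] -/
theorem ratCast_mem_top (q : ℚ) : (q : AlgebraicClosure ℚ) ∈ κ.top := by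
  have h := (κ.top).algebraMap_mem q
  rwa [eq_ratCast] at h

/-- If `x² ∈ ℚ` then `σx = ±x` for every `σ ∈ Γ_ℚ`. [folklore] -/
theorem smul_eq_or_eq_neg_of_sq_eq_ratCast {x : AlgebraicClosure ℚ} {q : ℚ} (hq : x ^ 2 = (q : AlgebraicClosure ℚ))
    (σ : absoluteGaloisGroup ℚ) : σ • x = x ∨ σ • x = -x := by
  apply eq_or_eq_neg_of_sq_eq_sq
  rw [← smul_pow', hq, MultTransportAtTwo.smul_ratCast]

/-- `√2 ∈ ℚ_∞` for the cyclotomic `ℤ₂`-extension, as an element of `ℚ̄` (tree `ZpExtension.IsCyclotomic.exists_sq_eq_two_layer_one`: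
`√2 ∈ ℚ_1`). [cite: Washington1997, §13.1] -/
theorem exists_mem_top_sq_eq_two (hκ : κ.IsCyclotomic) : ∃ θ : AlgebraicClosure ℚ, θ ∈ κ.top ∧ θ ^ 2 = 2 := by
  obtain ⟨θ, hθ⟩ := ZpExtension.IsCyclotomic.exists_sq_eq_two_layer_one hκ
  refine ⟨(θ : AlgebraicClosure ℚ), κ.layer_le_top 1 θ.2, ?_⟩
  have h := congrArg (algebraMap (κ.layer 1) (AlgebraicClosure ℚ)) hθ
  rw [map_pow, map_ofNat] at h
  exact h

/-- An element of `ℚ̄` with square `q ∈ ℚ` is `Γ_ℚ`-fixed iff `q` is a square in `ℚ` (`ℚ̄/ℚ` Galois). [folklore] -/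
theorem forall_smul_eq_iff_isSquare {x : AlgebraicClosure ℚ} {q : ℚ} (hq : x ^ 2 = (q : AlgebraicClosure ℚ)) :
    (∀ σ : absoluteGaloisGroup ℚ, σ • x = x) ↔ IsSquare q := by
  haveI : IsGalois ℚ (AlgebraicClosure ℚ) :=
    @IsAlgClosure.isGalois ℚ (AlgebraicClosure ℚ) _ _ (AlgebraicClosure.instAlgebra ℚ) inferInstance inferInstance
  constructor
  · intro h
    obtain ⟨r, hr⟩ := (InfiniteGalois.mem_range_algebraMap_iff_fixed x).mpr h
    rw [eq_ratCast] at hr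
    refine ⟨r, Rat.cast_injective (α := AlgebraicClosure ℚ) ?_⟩
    rw [Rat.cast_mul, ← hq, ← hr, pow_two]
  · rintro ⟨r, hr⟩ σ
    have hx : x = (r : AlgebraicClosure ℚ) ∨ x = -(r : AlgebraicClosure ℚ) := by
      apply eq_or_eq_neg_of_sq_eq_sq
      rw [hq, hr, Rat.cast_mul, pow_two]
    rcases hx with h | h
    · rw [h, MultTransportAtTwo.smul_ratCast]
    · rw [h, smul_neg, MultTransportAtTwo.smul_ratCast]

/-- **The quadratic numbers of the cyclotomic `ℤ₂`-tower**: for `x ∈ ℚ̄` with `x² = q ∈ ℚ`, `x ∈ ℚ_∞ ⟺ q ∈ ℚ^{×2} ∨ 2q ∈ ℚ^{×2}` —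
`ℚ_1 = ℚ(√2)` is the only quadratic subfield of `ℚ_∞` (`Gal(ℚ_∞/ℚ) ≅ ℤ₂` has one subgroup of index `2`). ⟹: if `x ∉ ℚ`, then `x` and
`√2` are irrational square roots in `ℚ_∞`, so `x√2 ∈ ℚ` (§1) and `2q = (x√2)²`; ⟸: `x = ±r` or `x = ±(s/2)√2`.
[cite: Washington1997, §13.1] -/
theorem mem_top_iff_isSquare_or_isSquare_two_mul (hκ : κ.IsCyclotomic) {x : AlgebraicClosure ℚ} {q : ℚ}
    (hq : x ^ 2 = (q : AlgebraicClosure ℚ)) : x ∈ κ.top ↔ IsSquare q ∨ IsSquare (2 * q) := by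
  obtain ⟨θ, hθtop, hθ2⟩ := exists_mem_top_sq_eq_two κ hκ
  have hθ2' : θ ^ 2 = ((2 : ℚ) : AlgebraicClosure ℚ) := by rw [hθ2, Rat.cast_ofNat]
  -- `2 ∉ ℚ^{×2}` (the tree's `Literature.Barriers.BirchSwinnertonDyer.curve480a1.not_isSquare_two`, re-derived to keep the import light)
  have h2sq : ¬ IsSquare (2 : ℚ) := by
    rw [show (2 : ℚ) = ((2 : ℕ) : ℚ) by norm_num, Rat.isSquare_natCast_iff]
    rintro ⟨r, hr⟩
    have hr2 : r ≤ 2 := by nlinarith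
    interval_cases r <;> omega
  have hθirr : ∃ σ₀ : absoluteGaloisGroup ℚ, σ₀ • θ ≠ θ := by
    by_contra! h
    exact h2sq ((forall_smul_eq_iff_isSquare hθ2').mp h)
  have hxθ2 : (x * θ) ^ 2 = ((2 * q : ℚ) : AlgebraicClosure ℚ) := by rw [mul_pow, hq, hθ2', Rat.cast_mul]; ring
  constructor
  · intro hx
    by_cases hrat : ∀ σ : absoluteGaloisGroup ℚ, σ • x = x
    · exact Or.inl ((forall_smul_eq_iff_isSquare hq).mp hrat)
    · right
      push Not at hrat
      exact (forall_smul_eq_iff_isSquare hxθ2).mp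
        (forall_smul_mul_eq κ hx hθtop (smul_eq_or_eq_neg_of_sq_eq_ratCast hq) (smul_eq_or_eq_neg_of_sq_eq_ratCast hθ2')
          hrat hθirr)
  · rintro (h | ⟨s, hs⟩)
    · -- `x = ±r ∈ ℚ ⊆ ℚ_∞`
      exact (mem_top_iff_forall_smul_eq κ x).mpr fun σ _ ↦ (forall_smul_eq_iff_isSquare hq).mpr h σ
    · -- `2q = s²`: `x θ = ±s`, so `x = ±(s/2) θ ∈ ℚ_∞`
      have hxθ : x * θ = (s : AlgebraicClosure ℚ) ∨ x * θ = -(s : AlgebraicClosure ℚ) := by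
        apply eq_or_eq_neg_of_sq_eq_sq
        rw [hxθ2, hs, Rat.cast_mul, pow_two]
      have hx' : x = x * θ * θ / 2 := by
        rw [mul_assoc, ← pow_two, hθ2]; ring
      have h2mem : (2 : AlgebraicClosure ℚ) ∈ κ.top := by
        have h := ratCast_mem_top κ 2
        rwa [Rat.cast_ofNat] at h
      have hmem : x * θ * θ / 2 ∈ κ.top := by
        refine div_mem (mul_mem ?_ hθtop) h2mem
        rcases hxθ with h | h
        · rw [h]; exact ratCast_mem_top κ s
        · rw [h]; exact neg_mem (ratCast_mem_top κ s)
      rw [hx']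
      exact hmem

end Rat

/-! ## §3 Elliptic curves over `ℚ`: `G_∞ ≅ S₃` iff `2Δ ∉ ℚ^{×2}` on the seed cell -/

section Elliptic

variable (W : WeierstrassCurve ℚ) [W.IsElliptic] (κ : ZpExtension ℚ 2)

/-- `q/16` is a square in `ℚ` iff `q` is. [folklore] -/
theorem isSquare_div_sixteen_iff (q : ℚ) : IsSquare (q / 16) ↔ IsSquare q := by
  constructor
  · rintro ⟨r, hr⟩
    exact ⟨4 * r, by linear_combination 16 * hr⟩
  · rintro ⟨r, hr⟩
    exact ⟨r / 4, by rw [hr]; ring⟩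

/-- `δ² = Δ/16` in `ℚ̄` (from the tree's `16 δ² = Δ`, `TowerImageDelta.sixteen_mul_delta_sq`). [cite: SilvermanAEC2009, III.§1] -/
theorem delta_sq_eq_ratCast : delta W two_ne_zero ^ 2 = ((W.Δ / 16 : ℚ) : AlgebraicClosure ℚ) := by
  have h16 := sixteen_mul_delta_sq W two_ne_zero
  rw [eq_ratCast] at h16
  rw [Rat.cast_div, Rat.cast_ofNat]
  linear_combination h16 / 16

/-- **`δ ∈ ℚ_∞ ⟺ Δ ∈ ℚ^{×2} ∨ 2Δ ∈ ℚ^{×2}`** (cyclotomic `ℤ₂`-extension; `16δ² = Δ`). [cite: Washington1997, §13.1]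
[cite: DokchitserDokchitserMathZ2012, Theorem (1), proof] -/
theorem delta_mem_top_iff (hκ : κ.IsCyclotomic) :
    delta W two_ne_zero ∈ κ.top ↔ IsSquare W.Δ ∨ IsSquare (2 * W.Δ) := by
  rw [mem_top_iff_isSquare_or_isSquare_two_mul κ hκ (delta_sq_eq_ratCast W), isSquare_div_sixteen_iff,
    show 2 * (W.Δ / 16) = 2 * W.Δ / 16 by ring, isSquare_div_sixteen_iff]

/-- **`Gal(ℚ̄/ℚ_∞)` contains a TRANSPOSITION on `E[2]` iff `Δ ∉ ℚ^{×2}` and `2Δ ∉ ℚ^{×2}`** (cyclotomic `ℤ₂`-extension, any `E/ℚ`).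
[cite: Washington1997, §13.1] [cite: DokchitserDokchitserMathZ2012, Theorem (1), proof] -/
theorem exists_transposition_mem_kerSubgroup_iff (hκ : κ.IsCyclotomic) :
    (∃ τ ∈ κ.kerSubgroup, ∃ m₀ v : W.geomTorsion 2, m₀ ≠ 0 ∧ τ • m₀ = m₀ ∧ τ • v ≠ v) ↔
      ¬ IsSquare W.Δ ∧ ¬ IsSquare (2 * W.Δ) := by
  rw [exists_transposition_mem_kerSubgroup_iff_delta_not_mem_top κ W two_ne_zero, delta_mem_top_iff W κ hκ, not_or]

/-- **On the seed cell (`Δ ∉ ℚ^{×2}`): `Gal(ℚ̄/ℚ_∞)` contains a transposition on `E[2]` iff `2Δ ∉ ℚ^{×2}`** — `G_∞ ⊄ A₃`.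
[cite: Washington1997, §13.1] [cite: Serre1972, §5.3] -/
theorem exists_transposition_mem_kerSubgroup_iff_not_isSquare (hκ : κ.IsCyclotomic) (hsq : ¬ IsSquare W.Δ) :
    (∃ τ ∈ κ.kerSubgroup, ∃ m₀ v : W.geomTorsion 2, m₀ ≠ 0 ∧ τ • m₀ = m₀ ∧ τ • v ≠ v) ↔ ¬ IsSquare (2 * W.Δ) := by
  rw [exists_transposition_mem_kerSubgroup_iff W κ hκ]
  exact ⟨fun h ↦ h.2, fun h ↦ ⟨hsq, h⟩⟩

/-- **On the seed cell: every element of `Gal(ℚ̄/ℚ_∞)` acts on `E[2]` trivially or without non-zero fixed point (`G_∞ ≤ A₃`, the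
hypothesis `hnoT` of the `C₃` counting lemma) iff `2Δ ∈ ℚ^{×2}`.** [cite: Washington1997, §13.1] [cite: Serre1972, §5.3] -/
theorem forall_trivial_or_fpf_iff_isSquare_two_mul (hκ : κ.IsCyclotomic) (hsq : ¬ IsSquare W.Δ) :
    (∀ g ∈ κ.kerSubgroup, (∀ m : W.geomTorsion 2, g • m = m) ∨ (∀ m : W.geomTorsion 2, g • m = m → m = 0)) ↔
      IsSquare (2 * W.Δ) := by
  rw [forall_trivial_or_fpf_iff_delta_mem_top κ W two_ne_zero, delta_mem_top_iff W κ hκ]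
  exact ⟨fun h ↦ h.resolve_left hsq, Or.inr⟩

/-- **`G_∞ ≅ S₃` case of the seed cell: `2Δ ∉ ℚ^{×2}`** (no rational `2`-torsion, cyclotomic `ℤ₂`-extension): `Gal(ℚ̄/ℚ_∞)` supplies
`σ` fixed-point-free, `τ` and `m₀ ≠ 0` with `τ m₀ = m₀`, `τ` non-trivial — the hypotheses of `PerfectDescent.natCard_equivariant_S3_bounds`.
Contains the whole `Δ < 0` half-cell. [cite: Serre1972, §5.3] [cite: Washington1997, §13.1] -/
theorem S3_data_of_not_isSquare_two_mul (hκ : κ.IsCyclotomic) (ht : ∀ x : ℚ, ¬ HasRationalTwoTorsionX W x)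
    (hsq : ¬ IsSquare W.Δ) (h2 : ¬ IsSquare (2 * W.Δ)) :
    ∃ σ ∈ κ.kerSubgroup, ∃ τ ∈ κ.kerSubgroup, ∃ m₀ : W.geomTorsion 2,
      (∀ m : W.geomTorsion 2, σ • m = m → m = 0) ∧ m₀ ≠ 0 ∧ τ • m₀ = m₀ ∧ ¬ ∀ m : W.geomTorsion 2, τ • m = m := by
  obtain ⟨σ, hσ, hfpf⟩ := exists_fpf_mem_kerSubgroup_of_forall_not_hasRationalTwoTorsionX W κ (by decide) ht
  obtain ⟨τ, hτ, m₀, v, hm₀, hτm₀, hτv⟩ := (exists_transposition_mem_kerSubgroup_iff_not_isSquare W κ hκ hsq).mpr h2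
  exact ⟨σ, hσ, τ, hτ, m₀, hfpf, hm₀, hτm₀, fun h ↦ hτv (h v)⟩

/-- **`G_∞ ≅ C₃` case of the seed cell: `2Δ ∈ ℚ^{×2}`** (no rational `2`-torsion, cyclotomic `ℤ₂`-extension; then `Δ > 0`):
`Gal(ℚ̄/ℚ_∞)` supplies a fixed-point-free `σ`, and every element acts trivially or fixed-point-freely — the hypotheses of
`PerfectDescent.natCard_equivariant_eq_of_no_transposition`. [cite: Serre1972, §5.3] [cite: Washington1997, §13.1] -/
theorem C3_data_of_isSquare_two_mul (hκ : κ.IsCyclotomic) (ht : ∀ x : ℚ, ¬ HasRationalTwoTorsionX W x)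
    (h2 : IsSquare (2 * W.Δ)) :
    (∃ σ ∈ κ.kerSubgroup, ∀ m : W.geomTorsion 2, σ • m = m → m = 0) ∧
      ∀ g ∈ κ.kerSubgroup, (∀ m : W.geomTorsion 2, g • m = m) ∨ (∀ m : W.geomTorsion 2, g • m = m → m = 0) :=
  ⟨exists_fpf_mem_kerSubgroup_of_forall_not_hasRationalTwoTorsionX W κ (by decide) ht,
    (forall_trivial_or_fpf_iff_delta_mem_top κ W two_ne_zero).mpr ((delta_mem_top_iff W κ hκ).mpr (Or.inr h2))⟩

/-- `2Δ ∈ ℚ^{×2}` forces `Δ > 0`: the `C₃` case lies in the `Δ > 0` half-cell (consistent with `TowerImage`: for `Δ < 0` complex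
conjugation is a transposition in `Gal(ℚ̄/ℚ_∞)`). [folklore] -/
theorem Δ_pos_of_isSquare_two_mul (h2 : IsSquare (2 * W.Δ)) : 0 < W.Δ := by
  obtain ⟨r, hr⟩ := h2
  have hΔ : W.Δ ≠ 0 := W.isUnit_Δ.ne_zero
  have hr0 : r ≠ 0 := fun h0 ↦ by rw [h0, mul_zero] at hr; exact hΔ (by linarith)
  nlinarith [mul_self_pos.mpr hr0]

end Elliptic

end Summit.BirchSwinnertonDyer.BirchSwinnertonDyer.Theorems.AlignedTransportAtTwoFineRoad.TowerImageQuadratic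

end
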